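import Summits.BirchSwinnertonDyer.BirchSwinnertonDyer.Theorems.ClassRecordThreeCartanOnePlaceDegreeLawAtThreeCMRankPrintInputsThree
import Summits.BirchSwinnertonDyer.BirchSwinnertonDyer.Theorems.ClassRecordThreeEulerHalvesAtThreeCartanCoverInertHecke
import Summits.BirchSwinnertonDyer.BirchSwinnertonDyer.Theorems.ClassRecordThreeEulerHalvesAtThreeCartanCoverPeriodLattice
import Summits.BirchSwinnertonDyer.BirchSwinnertonDyer.Theorems.ClassRecordThreeEulerHalvesAtThreeResidualUpperBoundCartanPlaceTwistLaw
import Literature.NumberTheory.EllipticCurves.SemistabilityDefectSerreFormulaProofs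
import HarnessLib

/-!
# Sketch (stub-ideation k = 2, Carayol-free) for `stub_jacquetVectorResidual` — helper-lemma SIGNATURES only

Nothing here is proved except the two glue theorems at the end; `sorry` marks the helpers (H2 tree-provable, H3 tree-provable,
H1/H1b are PRINT named-fact shapes = `def … : Prop`). See `STUB-IDEAS-stub_jacquetVectorResidual-2.md`.
-/

noncomputable section

open scoped Classical MatrixGroups NumberField
open Matrix IsDedekindDomain NumberField WeierstrassCurve
open Literature.NumberTheory.Automorphic Literature.NumberTheory.EllipticCurves
open Summit.BirchSwinnertonDyer.BirchSwinnertonDyer.Theorems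
open Summit.BirchSwinnertonDyer.BirchSwinnertonDyer.Theorems.CartanCover
open Summit.BirchSwinnertonDyer.BirchSwinnertonDyer.Theorems.CartanCover.Charext.InertHecke (upperUnip)
open Summit.BirchSwinnertonDyer.BirchSwinnertonDyer.Theorems.CartanCover.CMRank
open Literature.NumberTheory.EllipticCurves.Rank1Residual

namespace Summit.BirchSwinnertonDyer.BirchSwinnertonDyer.Cruxes.CartanOnePlaceDegreeLawAtThree.Jacquet.SideaK2

/-! ## Verbatim copies of (JV_Q) and (JV₇) from `Lines/jacquet.lean` rev 11 (l.1310, l.1327) — the Lines module is not built on the farm,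
so it cannot be imported here; the primed names below are character-for-character the registered statements. -/

/-- VERBATIM copy of `Jacquet.JacquetVectorDocked` (jacquet.lean l.1310). -/
def JacquetVectorDocked' : Prop :=
  ∀ (V : WeierstrassCurve ℚ) [V.IsElliptic] [V.IsGloballyMinimal], Surj V 3 →
    ∀ (N D M : ℕ) (C : Finset ℕ) (q : ℕ) [Fact q.Prime]
      (X : CartanLevelCurveData D M C) (W₁ : WeierstrassCurve ℚ) [W₁.IsElliptic] (Q : CartanParametrizationData X W₁)
      (hq : q ∈ C) (R : CoverReduction X q),
      V.conductorNorm ℤ = N → D * M * ∏ p ∈ C, p ^ 2 = N → q ≠ 3 → ¬ q ^ 3 ∣ N →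
      3 ∣ (V.baseChange ℚ_[q]).localTamagawaNumber ℤ_[q] → Q.IsMinimalFor V → q % 3 = 1 →
      ∃ x ∈ R.spanG (R.dockNonsplit hq Q.form), x ≠ 0 ∧ ∀ y : ZMod q, R.indRep (upperUnip y) x = x

/-- VERBATIM copy of `Jacquet.JacquetVectorResidual` (jacquet.lean l.1327) = the type of `stub_jacquetVectorResidual`. -/
def JacquetVectorResidual' : Prop :=
  ∀ (V : WeierstrassCurve ℚ) [V.IsElliptic] [V.IsGloballyMinimal], Surj V 3 →
    ∀ (N D M : ℕ) (C : Finset ℕ) (q : ℕ) [Fact q.Prime]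
      (X : CartanLevelCurveData D M C) (W₁ : WeierstrassCurve ℚ) [W₁.IsElliptic] (Q : CartanParametrizationData X W₁)
      (hq : q ∈ C) (R : CoverReduction X q),
      V.conductorNorm ℤ = N → D * M * ∏ p ∈ C, p ^ 2 = N → q ≠ 3 → ¬ q ^ 3 ∣ N →
      3 ∣ (V.baseChange ℚ_[q]).localTamagawaNumber ℤ_[q] → Q.IsMinimalFor V → q % 3 = 1 → q % 4 = 3 →
      ∃ x ∈ R.spanG (R.dockNonsplit hq Q.form), x ≠ 0 ∧ ∀ y : ZMod q, R.indRep (upperUnip y) x = x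

/-- VERBATIM copy of the tree's PROVED `Jacquet.jacquetVectorResidual_of_docked`. -/
theorem jacquetVectorResidual'_of_docked' (hJVQ : JacquetVectorDocked') : JacquetVectorResidual' :=
  fun V _ _ hS N D M C q _ X W₁ _ Q hq R hN hDMC hq3 hq3N hc hQ h1 _ ↦
    hJVQ V hS N D M C q X W₁ Q hq R hN hDMC hq3 hq3N hc hQ h1

/-! ## H1 (IGP) — the Igusa-part principle, conclusion-shaped (PRINT named fact; D-0026 debt) -/

/-- **H1 (IGP), PRINT.** If `V ~ W₁` acquires GOOD reduction over `ℚ(ζ_q)` at the primes over `q`, then the docked span `ℂ[G]·u_C`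
(`u_C = dockNonsplit (Q.form)`) contains a non-zero vector fixed by the upper unipotent subgroup `N(𝔽_q)`.
Print content: Néron model of `J(X_U)` over `ℤ_q[ζ_q]` (Katz–Mazur 13.7.6 ∕ Carayol 1986 §9.4, §10.3), Serre–Tate `V_ℓ(A)^I = V_ℓ(𝒜⁰_s)`,
Raynaud `Pic⁰ = 𝒜⁰`, Weil weights, and «`N` acts trivially on every Igusa component». NO local Langlands, NO Carayol Thm (A). -/
def IgusaPartJacquetVector : Prop :=
  ∀ (V : WeierstrassCurve ℚ) [V.IsElliptic] [V.IsGloballyMinimal]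
    (N D M : ℕ) (C : Finset ℕ) (q : ℕ) [Fact q.Prime]
    (X : CartanLevelCurveData D M C) (W₁ : WeierstrassCurve ℚ) [W₁.IsElliptic] (Q : CartanParametrizationData X W₁)
    (hq : q ∈ C) (R : CoverReduction X q),
    V.conductorNorm ℤ = N → D * M * ∏ p ∈ C, p ^ 2 = N → ¬ q ^ 3 ∣ N → Q.IsMinimalFor V →
    (∀ w : HeightOneSpectrum (𝓞 (CyclotomicField q ℚ)), (q : 𝓞 (CyclotomicField q ℚ)) ∈ w.asIdeal →
        (V.baseChange (CyclotomicField q ℚ)).HasGoodReductionAt w) →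
    ∃ x ∈ R.spanG (R.dockNonsplit hq Q.form), x ≠ 0 ∧ ∀ y : ZMod q, R.indRep (upperUnip y) x = x

/-! ## H1b (IGPᵐ) — module-shaped variant: `u_C` lies in the `G`-span of finitely many `N`-fixed vectors (PRINT) -/

/-- **H1b (IGPᵐ), PRINT.** Same hypotheses; conclusion: `u_C ∈ Σ_{s ∈ S} ℂ[G]·s` for a finite set `S` of `N(𝔽_q)`-fixed vectors of the induced
module (in print: `u_C` lies in the NON-CUSPIDAL part `ℂ[G]·(IndCuspForm)^N` because the `V`-part of `J(X_U)` has good reduction over `ℚ_q(ζ_q)`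
and the reduction of the Katz–Mazur–Carayol model has only Igusa components, on which `N` acts trivially). H1b ∧ H3 ⟹ H1. -/
def IgusaPartGenerated : Prop :=
  ∀ (V : WeierstrassCurve ℚ) [V.IsElliptic] [V.IsGloballyMinimal]
    (N D M : ℕ) (C : Finset ℕ) (q : ℕ) [Fact q.Prime]
    (X : CartanLevelCurveData D M C) (W₁ : WeierstrassCurve ℚ) [W₁.IsElliptic] (Q : CartanParametrizationData X W₁)
    (hq : q ∈ C) (R : CoverReduction X q),
    V.conductorNorm ℤ = N → D * M * ∏ p ∈ C, p ^ 2 = N → ¬ q ^ 3 ∣ N → Q.IsMinimalFor V →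
    (∀ w : HeightOneSpectrum (𝓞 (CyclotomicField q ℚ)), (q : 𝓞 (CyclotomicField q ℚ)) ∈ w.asIdeal →
        (V.baseChange (CyclotomicField q ℚ)).HasGoodReductionAt w) →
    ∃ S : Finset R.IndCuspForm, (∀ s ∈ S, ∀ y : ZMod q, R.indRep (upperUnip y) s = s) ∧
      R.dockNonsplit hq Q.form ∈ ⨆ s ∈ S, R.spanG s

/-! ## H2 (T₃) — the `V`-side detector: `3 ∣ c_q`, `q² ∥ N`, `q ≡ 1 (3)` ⟹ good reduction over `ℚ(ζ_q)` (TREE-PROVABLE) -/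

/-- **H2 (T₃), TREE-PROVABLE.** Chain: `CartanPlaceTwistLaw.hasAdditiveReductionAt_of_sq_dvd_conductorNorm` →
`CartanPlaceTwistLaw.kodairaSymbolAt_IV_or_IVstar_of_additive_of_three_dvd` (Kodaira IV ∕ IV*) →
`WeierstrassCurve.ordMinimalDiscriminant_eq_numComponentsAt_add_one_holds` (`v_q Δ_min ∈ {4, 8}`) → `0 ≤ v_q(j)` (sibling of
`padicValRat_j_nonneg_of_kodairaSymbolAt_eq_III_or_IIIstar`) → `hasGoodReductionAt_baseChange_of_twelve_dvd_ramificationIdx_mul`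
with `e(w ∣ q) = q − 1` (Mathlib `IsCyclotomicExtension.Rat.ramificationIdx_eq_of_prime_pow`, tree
`IsCyclotomicExtension.Rat.ramificationIdx_eq_finrank_of_algebra`) and `12 ∣ (q − 1)·4` from `q % 3 = 1`. -/
theorem cyclotomicGoodReduction_of_cartanPlaceAtThree
    (V : WeierstrassCurve ℚ) [V.IsElliptic] [V.IsGloballyMinimal] {N q : ℕ} [Fact q.Prime]
    (hN : V.conductorNorm ℤ = N) (hq2 : q ^ 2 ∣ N) (hq3N : ¬ q ^ 3 ∣ N) (h5 : 5 ≤ q)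
    (hc : 3 ∣ (V.baseChange ℚ_[q]).localTamagawaNumber ℤ_[q]) (h1 : q % 3 = 1)
    (w : HeightOneSpectrum (𝓞 (CyclotomicField q ℚ))) (hw : (q : 𝓞 (CyclotomicField q ℚ)) ∈ w.asIdeal) :
    (V.baseChange (CyclotomicField q ℚ)).HasGoodReductionAt w := by
  sorry

/-! ## H3 — Maschke extraction (TREE-PROVABLE finite-group lemma) -/

/-- **H3, TREE-PROVABLE (Maschke, `MonoidAlgebra.Submodule.exists_isCompl`).** If a non-zero `u` lies in the `G`-span of finitely many
`N`-fixed vectors, then `ℂ[G]·u` contains a non-zero `N`-fixed vector (project the generators `G`-equivariantly onto `ℂ[G]·u`). -/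
theorem exists_unipFixed_of_mem_iSup_spanG {D M : ℕ} {C : Finset ℕ} {X : CartanLevelCurveData D M C} {q : ℕ} [Fact q.Prime]
    (R : CoverReduction X q) (u : R.IndCuspForm) (hu : u ≠ 0) (S : Finset R.IndCuspForm)
    (hS : ∀ s ∈ S, ∀ y : ZMod q, R.indRep (upperUnip y) s = s) (hmem : u ∈ ⨆ s ∈ S, R.spanG s) :
    ∃ x ∈ R.spanG u, x ≠ 0 ∧ ∀ y : ZMod q, R.indRep (upperUnip y) x = x := by
  sorry

/-! ## Glue (REAL proofs): H1b ∧ H3 ⟹ H1;  H1 ∧ H2 ⟹ (JV_Q) ⟹ (JV₇) = the stub -/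

theorem igusaPartJacquetVector_of_generated (h : IgusaPartGenerated) : IgusaPartJacquetVector := by
  intro V _ _ N D M C q _ X W₁ _ Q hq R hN hDMC hq3N hQ hgood
  obtain ⟨S, hS, hmem⟩ := h V N D M C q X W₁ Q hq R hN hDMC hq3N hQ hgood
  exact exists_unipFixed_of_mem_iSup_spanG R _ (dockNonsplit_form_ne_zero Q hq R) S hS hmem

theorem jacquetVectorDocked_of_igusaPart (hIGP : IgusaPartJacquetVector) : JacquetVectorDocked' := by
  intro V _ _ hS N D M C q _ X W₁ _ Q hq R hN hDMC hq3 hq3N hc hQ h1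
  refine hIGP V N D M C q X W₁ Q hq R hN hDMC hq3N hQ ?_
  intro w hw
  have hq2 : q ^ 2 ∣ N := by
    rw [← hDMC]; exact Dvd.dvd.mul_left (Finset.dvd_prod_of_mem (fun p => p ^ 2) hq) _
  have h5 : 5 ≤ q := by
    have hp : q.Prime := Fact.out
    have h2 := hp.two_le
    by_contra hlt
    interval_cases q <;> first | omega | exact absurd hp (by decide)
  exact cyclotomicGoodReduction_of_cartanPlaceAtThree V hN hq2 hq3N h5 hc h1 w hw

/-- The stub, from H1 (and H2 inside `jacquetVectorDocked_of_igusaPart`), via the tree's PROVED `jacquetVectorResidual_of_docked`. -/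
theorem jacquetVectorResidual_of_igusaPart (hIGP : IgusaPartJacquetVector) : JacquetVectorResidual' :=
  jacquetVectorResidual'_of_docked' (jacquetVectorDocked_of_igusaPart hIGP)

end Summit.BirchSwinnertonDyer.BirchSwinnertonDyer.Cruxes.CartanOnePlaceDegreeLawAtThree.Jacquet.SideaK2
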